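import Summits.ABC.IUTFork.Repair.CandJoshi23Price
import Summits.ABC.IUTFork.Repair.CandJoshi1
import Summits.ABC.IUTFork.Repair.CandJoshi3
import Summits.ABC.IUTFork.Repair.Barrier
import Summits.ABC.IUTFork.Repair.CandJoshi32
import HarnessLib

/-!
# IUT REPAIR BRANCH (LADDER-ABC:A2.RP), class (iii) JOSHI, j2 — the VAL COLUMN: the class-(iii) candidate predicates EVALUATED on the
# value-chart bed `CandJoshi23` (a bed for the T-b PROFILE: non-isometric, honest volumes, finite, all three pins)

Record file of the abc-iut cell's IUT REPAIR BRANCH (seat abc-iut-rp-j2, gen 2; bed VAL = `valSetting p` / `vRho p` / `vQDatum p` of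
`Repair/CandJoshi23` p437744, tests p438692, price sheet p439085). TAKES NO SIDE on [IUTchIII] Cor. 3.12 or on any author. PROOF-ONLY
(0 defs); no `Prop` fact; interface-level toy over `toyIndex`; typed ≠ proved ≠ endorsed. Every predicate is CITED BY NAME from its author's
file (abc-iut-rp-j1 `CandJoshi1`/`CandJoshi3`, abc-iut-rp-j2 `CandJoshi21`, abc-iut-rp-bar `Barrier`), never restated.

THE VAL COLUMN (every prime `p`; kernel names in brackets):
* residual level — S `PilotKummerIndRelated` ✓ (`val_residual`, Tests) · C `PilotKummerCompat` ✓ (`val_pilotKummerCompat`) · `GapA″`/`GapA3` ✓ ·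
  RP-I-type `VolumePinned` (BAR-V's necessary condition under Step (x)) ✗ (`val_not_volumePinned`: `−log p ≠ −4·log p`) — so on VAL «S ∧ ¬VolumePinned»:
  BAR-V's Step (x) hypothesis is load-bearing;
* RP-J03 — H_J21-1 `JoshiAnsatzQReading` ✗ (`val_not_ansatzQReading`) · H_J21-3 `JoshiTopNormalized` ✗ (`val_not_topNormalized`: honest direction,
  `H_1 ⊄ H_4`) · H_J21-4 `JoshiLocalPrototype` ✓ (`val_localPrototype`: `−log p ≤ 0`);
* RP-J05 — H_J21-2 ✓ / H_J21-5 ✓ (Tests: `val_H2`, `val_H5`);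
* RP-J01 — H_J1 `JoshiDominance` ✓ (`val_joshiDominance`) · H_J2 `JoshiVolumeDominance` ✓ (`val_joshiVolumeDominance`);
* RP-J02 — H_J3 `LocusCovers` ✓ (`val_locusCovers`) · H_J3′ `ShellFilling` ✗ (`val_not_shellFilling`) BUT ONLY AT THE BOUNDARY: every hull-set
  strictly inside the unit shell and above a Θ-image IS a possible image (`val_shellFilling_off_boundary` — the locus `{H_{u·j²} | u > 0}` fills the
  open shell; the shell `H_0` itself is the one hull-set missed) — the first bed of record on which locus-filling holds up to the boundary
  (abc-iut-rp-j1's profile p432070: H_J3′ fails on every isometric/Haar bed);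
* hull / Statement level — `Licence` ✓, `GapH3` ✓ (`val_licence`, `val_gapH3`), typed Statement ✓ (Price: `val_statement`, `−|log(Θ)| = 0`);
* the ∀-form's remaining hypothesis hθ ✓ (`val_hθ`; with Tests' hAdm ✓ / hvol ✗ / hscaled / hneg and the model's KummerB / pins: exactly ONE
  hypothesis of `PinnedHonest.not_gapA''_of_scaledAt` fails on VAL).
`val_profile` packages the column. CENSUS USE: the class-(iii) suppliers J01a/b, J02a, J05 and the Statement-level J21-4 are JOINTLY satisfied,
together with S, C, GapA3, GapH3, the typed Statement, BridgeHyps, the three pins and honest volumes, on ONE non-isometric bed; what separates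
them from print's data is the single clause Step (x) log-volume invariance (and, for J21-1/J21-3/VolumePinned, honest `j²` itself).
[claim: Mochizuki2012, status: disputed] [claim: Joshi2023ATS2Local, status: disputed] [claim: Joshi2024ATSIII, status: disputed]
-/

noncomputable section

open Set

namespace Summit.ABC.IUTFork.Repair.CandJoshi23

open Thm311 Cor312 Cor312.Checks Cor312.IdentifiedNonVacuity Cor312Vol Cor312Vol.NaiveWitness Cor312Vol.UnitWitness
  Cor312Vol.PinnedWitness Literature.IUT.LogThetaLattice Summit.ABC.IUTFork.Repair Summit.ABC.IUTFork.Repair.ScalarShells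
  Summit.ABC.IUTFork.Repair.ScalarShellsThm311

variable (p : ℕ)

/-! ## 1. Residual level: C, VolumePinned, hθ -/

/-- **C `PilotKummerCompat` HOLDS on VAL** (abc-iut-rp-j2's `scalingIndeterminacy_iff_pilotKummerCompat` under (ii)(b), from `val_H2`).
[claim: Mochizuki2012, status: disputed] -/
theorem val_pilotKummerCompat : PilotKummerCompat (vFull p).toLatticeSituation (valSetting p) (vQDatum p) :=
  (scalingIndeterminacy_iff_pilotKummerCompat _ _ _ (val_kummerB p 0)).1 (val_H2 p)

/-- (hθ) every (Ind3)-enlarged Θ-region is admissible on VAL (it is `H_{j²}`). [folklore] -/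
theorem val_hθ (j : toyIndex.Label) (vQ : toyIndex.VQ) : (vData p).Adm j vQ ((valSetting p).thetaRegion3 j vQ) :=
  ⟨_, valSetting_thetaRegion3 p j vQ⟩

variable [hp : Fact p.Prime]

/-- **abc-iut-rp-bar's `VolumePinned` FAILS on VAL** (at label `2`: `μ(H_1) = −log p ≠ −4·log p = μ(H_4)`) — although S holds: BAR-V's
volume mechanism needs Step (x), which VAL denies. [claim: Mochizuki2012, status: disputed] -/
theorem val_not_volumePinned : ¬ VolumePinned (vFull p).toLatticeSituation (valSetting p) (vRho p) (vQDatum p) := fun h => by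
  have h2 := h 2 ()
  have hΨ : ((vFull p).toLatticeSituation.D (valSetting p).n).Ψ = fun v _ => vPsi p v := rfl
  rw [hΨ, vRho_vPsi, vRho_vQDatum, if_neg (by decide : (2 : toyIndex.Label) ≠ 0)] at h2
  have h2' : vVol p 2 () (vHalf p 2 () 1) = vVol p 2 () (vHalf p 2 () (jsq (2 : toyIndex.Label) : ℚ)) := h2
  rw [vVol_vHalf, vVol_vHalf, show (jsq (2 : toyIndex.Label) : ℚ) = 4 by unfold jsq; rw [label_two_val]; norm_num] at h2'
  have := log_p_pos p
  push_cast at h2'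
  linarith

/-! ## 2. RP-J03: the Ansatz q-reading and the top normalisation FAIL (honest direction), the local prototype HOLDS -/

omit hp in
/-- `H_1 ≠ H_4` and `H_1 ⊄ H_4` at label `2`: the point of valuation `1` lies in `H_1`, not in `H_4`. [folklore] -/
theorem vHalf_one_not_subset_four : ¬ vHalf p 2 () 1 ⊆ vHalf p 2 () (jsq (2 : toyIndex.Label) : ℚ) := fun h => by
  have h1 := le_of_vHalf_subset p h
  rw [show (jsq (2 : toyIndex.Label) : ℚ) = 4 by unfold jsq; rw [label_two_val]; norm_num] at h1
  linarith

omit hp in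
/-- **H_J21-1 `JoshiAnsatzQReading` FAILS on VAL** (`ρ(q_K) = H_1 ≠ H_4 = ρ(Ψ_n)` at label `2`). [claim: Joshi2023ATS2Local, status: disputed] -/
theorem val_not_ansatzQReading : ¬ JoshiAnsatzQReading (vFull p).toLatticeSituation (valSetting p) (vRho p) (vQDatum p) := fun h => by
  have h2 := h 2 ()
  have hΨ : ((vFull p).toLatticeSituation.D (valSetting p).n).Ψ = fun v _ => vPsi p v := rfl
  rw [hΨ, vRho_vPsi, vRho_vQDatum, if_neg (by decide : (2 : toyIndex.Label) ≠ 0)] at h2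
  exact vHalf_one_not_subset_four p h2.subset

omit hp in
/-- **H_J21-3 `JoshiTopNormalized` FAILS on VAL** (honest direction: `ρ(q_K) = H_1 ⊄ H_4 = ρ(Ψ_n)` at label `2`). [claim: Joshi2023ATS2Local, status: disputed] -/
theorem val_not_topNormalized : ¬ JoshiTopNormalized (vFull p).toLatticeSituation (valSetting p) (vRho p) (vQDatum p) := fun h => by
  have h2 := h 2 ()
  have hΨ : ((vFull p).toLatticeSituation.D (valSetting p).n).Ψ = fun v _ => vPsi p v := rfl
  rw [hΨ, vRho_vPsi, vRho_vQDatum, if_neg (by decide : (2 : toyIndex.Label) ≠ 0)] at h2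
  exact vHalf_one_not_subset_four p h2

/-- **H_J21-4 `JoshiLocalPrototype` HOLDS on VAL** (`qLocal = −log p ≤ 0 = thetaLocal` at every label of `𝔽_l^⋇`). [claim: Joshi2023ATS2Local, status: disputed] -/
theorem val_localPrototype : JoshiLocalPrototype (valSetting p) := fun i vQ => by
  rw [val_qLocal, val_thetaLocal]
  have := log_p_pos p
  show -Real.log p ≤ (0 : ℝ)
  linarith

/-! ## 3. RP-J01 / RP-J02: dominance, volume dominance, locus covering HOLD; locus FILLING fails only at the boundary -/

omit hp in
/-- **H_J1 `JoshiDominance` HOLDS on VAL** (abc-iut-rp-j1's `joshiDominance_of_pilotKummerIndRelated`, from S, (ii)(b) and (hρ)).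
[claim: Joshi2024ATSIII, status: disputed] -/
theorem val_joshiDominance : CandJoshi1.JoshiDominance (vFull p).toLatticeSituation (valSetting p) (vRho p) (vQDatum p) :=
  CandJoshi1.joshiDominance_of_pilotKummerIndRelated _ _ _ _ (val_kummerB p 0) (fun _ hΦ X j vQ => vRho_equivariant p hΦ X j vQ)
    (val_residual p)

/-- **H_J2 `JoshiVolumeDominance` HOLDS on VAL** (rp-j1's `joshiVolumeDominance_of_joshiDominance`, under BridgeHyps and the pins).
[claim: Joshi2024ATSIII, status: disputed] -/
theorem val_joshiVolumeDominance : CandJoshi1.JoshiVolumeDominance (valSetting p) :=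
  CandJoshi1.joshiVolumeDominance_of_joshiDominance _ _ _ _ (val_bridgeHyps p) (val_pinnedRegions3 p).1 (val_joshiDominance p)

omit hp in
/-- **H_J3 `LocusCovers` HOLDS on VAL** (rp-j1's `locusCovers_of_reading3`, from R3 and the q-pin). [claim: Joshi2021ATSII, status: disputed] -/
theorem val_locusCovers : CandJoshi3.LocusCovers (vFull p).toLatticeSituation (valSetting p) (vRho p) (vQDatum p) :=
  CandJoshi3.locusCovers_of_reading3 _ _ _ _ (val_pinnedRegions3 p).1.2 (val_reading3 p)

omit hp in
/-- Every possible image at a label of `𝔽_l^⋇` is a half-line of POSITIVE threshold (`H_{u·j²}`, `u > 0`) — so the unit shell `H_0` is not one.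
[folklore] -/
theorem val_possibleImages_pos (i : Fin toyIndex.lstar) (vQ : toyIndex.VQ) {U : Set ((valShells p).Packet (Setting.labelSucc i) vQ)}
    (hU : U ∈ (valSetting p).possibleImages (Setting.labelSucc i) vQ) : ∃ a : ℚ, 0 < a ∧ U = vHalf p _ vQ a := by
  obtain ⟨Φ, hΦ, rfl⟩ := hU
  obtain ⟨u, hu, hΦc⟩ := (ScalarShells.actsByScalars_of_mem_closure hΦ).scalar _ vQ
  have hu0 : (0 : ℚ) < u := (Units.mem_posSubgroup _).1 hu
  exact ⟨_, mul_pos hu0 (jsq_labelSucc_pos i), by rw [valSetting_thetaRegion3, image_vHalf_of_line_eq p _ hu0 hΦc]⟩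

omit hp in
/-- **H_J3′ `ShellFilling` FAILS on VAL — at the boundary only**: the unit shell `H_0` at label `2` is a hull-set above the Θ-image `H_4` and
inside the integral structure `H_0`, but it is NOT a possible image (those are the `H_{4u}`, `u > 0`). [claim: Joshi2021ATSII, status: disputed] -/
theorem val_not_shellFilling : ¬ CandJoshi3.ShellFilling (vFull p).toLatticeSituation (valSetting p) (vRho p) := fun h => by
  have hΨ : ∀ m : ℤ, ((vFull p).toLatticeSituation.col (valSetting p).n).frobΨ m = fun v _ => vPsi p v := fun _ => rfl
  have h0 := h (Setting.labelSucc (⟨1, by decide⟩ : Fin toyIndex.lstar)) () (vHalf p _ () 0) ⟨0, rfl⟩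
    ⟨0, by rw [hΨ, vRho_vPsi]; exact vHalf_anti p (le_of_lt (jsq_labelSucc_pos _))⟩ subset_rfl
  obtain ⟨a, ha, h0a⟩ := val_possibleImages_pos p _ () h0
  have := (vHalf_eq_iff p).1 h0a
  linarith

omit hp in
/-- **… and NOWHERE ELSE: locus-filling OFF THE BOUNDARY HOLDS on VAL** — every hull-set above a Θ-image and strictly inside the integral
structure is a possible image (the locus `{H_{u·j²} | u > 0}` fills the open unit shell; at the junk label only the shell itself qualifies).
[claim: Joshi2021ATSII, status: disputed] -/
theorem val_shellFilling_off_boundary (j : toyIndex.Label) (vQ : toyIndex.VQ) (H' : Set ((valShells p).Packet j vQ))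
    (hH' : H' ∈ ((valSetting p).frame j vQ).Hul)
    (hΘ : ∃ m : ℤ, vRho p (((vFull p).toLatticeSituation.col (valSetting p).n).frobΨ m) j vQ ⊆ H')
    (hsh : H' ⊆ ((vFull p).toLatticeSituation.D (valSetting p).n).shellPk j vQ)
    (hne : H' ≠ ((vFull p).toLatticeSituation.D (valSetting p).n).shellPk j vQ) : H' ∈ (valSetting p).possibleImages j vQ := by
  obtain ⟨a, rfl⟩ := hH'
  obtain ⟨m, hm⟩ := hΘ
  have hΨ : ((vFull p).toLatticeSituation.col (valSetting p).n).frobΨ m = fun v _ => vPsi p v := rfl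
  rw [hΨ, vRho_vPsi] at hm
  have ha0 : 0 ≤ a := le_of_vHalf_subset p hsh
  have hne' : a ≠ 0 := fun h => hne (by rw [h]; rfl)
  have ha : 0 < a := lt_of_le_of_ne ha0 (Ne.symm hne')
  by_cases hj : j = 0
  · -- at the junk label the Θ-image is the shell itself: `H_0 ⊆ H_a` forces `a ≤ 0`
    subst hj
    rw [jsq_zero_cast] at hm
    exact absurd (le_antisymm (le_of_vHalf_subset p hm) ha0) hne'
  · have hq : 0 < (jsq j : ℚ) := by
      unfold jsq
      have : 0 < (j : ℕ) := Nat.pos_of_ne_zero fun h => hj (Fin.ext h)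
      positivity
    have hc0 : 0 < a / (jsq j : ℚ) := div_pos ha hq
    refine ⟨headFam p (fun _ => Units.mk0 _ hc0.ne'), ?_, ?_⟩
    · exact Subgroup.subset_closure (Or.inr (headFam_mem_Ind2Family fun _ => (Units.mem_posSubgroup _).2 hc0))
    · rw [valSetting_thetaRegion3, image_vHalf_of_line_eq p _ hc0 (line_headFam p _ _ vQ), div_mul_cancel₀ _ hq.ne']

/-! ## 4. Hull / Statement level -/

omit hp in
/-- **`Licence` HOLDS on VAL** (`H_1 ⊆ H_0 = ^{n,∘}𝒰`). [claim: Mochizuki2012, status: disputed] -/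
theorem val_licence : Thm311ToCor312.Licence (valSetting p) := fun i vQ => by
  rw [valSetting_qRegion, if_neg (Setting.labelSucc_ne_zero i), val_thetaHull]
  exact vHalf_anti p zero_le_one

omit hp in
/-- **`GapH3` HOLDS on VAL** (non-vacuously: the pins hold). [claim: Mochizuki2012, status: disputed] -/
theorem val_gapH3 : GapH3 (vFull p).toLatticeSituation (valSetting p) (vRho p) (vQDatum p) := fun _ => val_licence p

/-! ## 5. The VAL column, packaged -/

/-- **`val_profile` — THE VAL COLUMN of the T-b PROFILE** (class (iii) predicates + C + VolumePinned + hull level, on one non-isometric,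
finite, honest-volume, three-pin bed). [claim: Joshi2023ATS2Local, status: disputed] -/
theorem val_profile :
    PilotKummerIndRelated (vFull p).toLatticeSituation (valSetting p) (vRho p) (vQDatum p) ∧
      PilotKummerCompat (vFull p).toLatticeSituation (valSetting p) (vQDatum p) ∧
      ¬ VolumePinned (vFull p).toLatticeSituation (valSetting p) (vRho p) (vQDatum p) ∧
      ¬ JoshiAnsatzQReading (vFull p).toLatticeSituation (valSetting p) (vRho p) (vQDatum p) ∧
      ¬ JoshiTopNormalized (vFull p).toLatticeSituation (valSetting p) (vRho p) (vQDatum p) ∧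
      JoshiLocalPrototype (valSetting p) ∧
      JoshiScalingIndeterminacy (vFull p).toLatticeSituation (valSetting p) (vQDatum p) ∧
      JoshiNonIsometricIndeterminacy (vSituation p) (valSetting p).n ∧
      CandJoshi1.JoshiDominance (vFull p).toLatticeSituation (valSetting p) (vRho p) (vQDatum p) ∧
      CandJoshi1.JoshiVolumeDominance (valSetting p) ∧
      CandJoshi3.LocusCovers (vFull p).toLatticeSituation (valSetting p) (vRho p) (vQDatum p) ∧
      ¬ CandJoshi3.ShellFilling (vFull p).toLatticeSituation (valSetting p) (vRho p) ∧
      Thm311ToCor312.Licence (valSetting p) ∧ GapH3 (vFull p).toLatticeSituation (valSetting p) (vRho p) (vQDatum p) ∧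
      (valSetting p).Statement ∧ BridgeHyps (valSetting p) ∧
      PinnedRegions3 (vFull p).toLatticeSituation (valSetting p) (vRho p) (vQDatum p) :=
  ⟨val_residual p, val_pilotKummerCompat p, val_not_volumePinned p, val_not_ansatzQReading p, val_not_topNormalized p,
    val_localPrototype p, val_H2 p, val_H5 p _, val_joshiDominance p, val_joshiVolumeDominance p, val_locusCovers p,
    val_not_shellFilling p, val_licence p, val_gapH3 p, val_statement p, val_bridgeHyps p, val_pinnedRegions3 p⟩

/-! ## 6. abc-iut-rp-j3's (Ind3)^J homothety rows RP-J32a/b/c on VAL (appended, abc-iut-rp-j2 gen 2): in the value chart a positive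
homothety of the packet line IS a positive scaling, i.e. an (Ind2)-move — door (c) and door (a) COINCIDE here -/

omit hp in
/-- The line coordinate of `c • x` is `c · line x` (w5-d155's `line_smul`, re-elaborated on the value-chart packets). [folklore] -/
theorem line_smul' {j : toyIndex.Label} {vQ : toyIndex.VQ} (c : ℚ) (x : (valShells p).Packet j vQ) :
    line j vQ (c • x) = c * line j vQ x := by
  rw [← smul_eq_mul]
  exact (line j vQ).map_smul c x

omit hp in
/-- A positive homothety `x ↦ c • x` of the packet line carries `H_a` onto `H_{c·a}`. [folklore] -/
theorem image_smul_vHalf {j : toyIndex.Label} {vQ : toyIndex.VQ} {c : ℚ} (hc : 0 < c) (a : ℚ) :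
    (fun x : (valShells p).Packet j vQ => c • x) '' vHalf p j vQ a = vHalf p j vQ (c * a) := by
  apply Set.Subset.antisymm
  · rintro _ ⟨x, hx, rfl⟩
    show c * a ≤ line j vQ (c • x)
    rw [line_smul' p c x]
    exact mul_le_mul_of_nonneg_left hx hc.le
  · intro y hy
    refine ⟨c⁻¹ • y, ?_, ?_⟩
    · show a ≤ line j vQ (c⁻¹ • y)
      rw [line_smul' p c⁻¹ y]
      rw [mem_vHalf] at hy
      have h : c * a ≤ c * (c⁻¹ * line j vQ y) := by rwa [← mul_assoc, mul_inv_cancel₀ hc.ne', one_mul]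
      exact le_of_mul_le_mul_left h hc
    · show c • c⁻¹ • y = y
      rw [smul_smul, mul_inv_cancel₀ hc.ne', one_smul]

omit hp in
/-- **RP-J32a `CandJoshi32.H` ((Ind3)^J homothety-relatedness, per packet) HOLDS on VAL** — with `c = 1/j²` at label `j` (`1` at the junk label):
the homothety IS the line action of the (Ind2)-move `jMove` at label `2`. [claim: Joshi2024ATSIII, status: disputed] -/
theorem val_J32a : CandJoshi32.H (vFull p).toLatticeSituation (valSetting p) (vRho p) (vQDatum p) := fun j vQ => by
  have hΨ : ((vFull p).toLatticeSituation.D (valSetting p).n).Ψ = fun v _ => vPsi p v := rfl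
  rw [hΨ, vRho_vPsi, vRho_vQDatum]
  by_cases hj : j = 0
  · subst hj
    refine ⟨1, one_ne_zero, ?_⟩
    rw [if_pos rfl, CandJoshi32.image_one_smul, jsq_zero_cast]
  · have hq : 0 < (jsq j : ℚ) := by
      unfold jsq
      have : 0 < (j : ℕ) := Nat.pos_of_ne_zero fun h => hj (Fin.ext h)
      positivity
    refine ⟨(jsq j : ℚ)⁻¹, inv_ne_zero hq.ne', ?_⟩
    rw [if_neg hj, image_smul_vHalf p (inv_pos.2 hq), inv_mul_cancel₀ hq.ne']

omit hp in
/-- **RP-J32b `CandJoshi32.H'` (ONE homothety for all labels) FAILS on VAL**, non-vacuously: label `1` forces `c = 1` (indeed `c ≥ 1`),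
label `2` forces `c = 1/4`. [claim: Joshi2024ATSIII, status: disputed] -/
theorem val_not_J32b : ¬ CandJoshi32.H' (vFull p).toLatticeSituation (valSetting p) (vRho p) (vQDatum p) := by
  rintro ⟨c, hc, h⟩
  have hΨ : ((vFull p).toLatticeSituation.D (valSetting p).n).Ψ = fun v _ => vPsi p v := rfl
  have h1 := h ⟨0, by decide⟩ ()
  have h2 := h ⟨1, by decide⟩ ()
  rw [hΨ, vRho_vPsi, vRho_vQDatum, if_neg (Setting.labelSucc_ne_zero _)] at h1 h2
  -- label 1: `pt 1 ∈ H_1 = c • H_1`, so `1 = c · (line x)` with `line x ≥ 1`; hence `0 < c`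
  have hj1 : (jsq (Setting.labelSucc (⟨0, by decide⟩ : Fin toyIndex.lstar)) : ℚ) = 1 := by
    unfold jsq; rw [show ((Setting.labelSucc (⟨0, by decide⟩ : Fin toyIndex.lstar) : toyIndex.Label) : ℕ) = 1 from rfl]; norm_num
  have hj2 : (jsq (Setting.labelSucc (⟨1, by decide⟩ : Fin toyIndex.lstar)) : ℚ) = 4 := by
    unfold jsq; rw [show ((Setting.labelSucc (⟨1, by decide⟩ : Fin toyIndex.lstar) : toyIndex.Label) : ℕ) = 2 from rfl]; norm_num
  rw [hj1] at h1
  rw [hj2] at h2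
  have hmem : pt p _ () 1 ∈ (fun x : (valShells p).Packet _ () => c • x) '' vHalf p _ () 1 := h1 ▸ pt_mem_vHalf p _ () 1
  obtain ⟨x, hx, hxe⟩ := hmem
  have hcx : c * line _ () x = 1 := by
    have h' := congrArg (line _ ()) hxe
    dsimp only at h'
    rwa [line_smul', line_pt] at h'
  rw [mem_vHalf] at hx
  have hc0 : 0 < c := by
    by_contra hle
    have hle' : c ≤ 0 := not_lt.mp hle
    nlinarith
  -- with `0 < c`: label 1 gives `c = 1`, label 2 gives `4c = 1`
  rw [image_smul_vHalf p hc0, vHalf_eq_iff] at h1 h2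
  linarith

omit hp in
/-- **RP-J32c `CandJoshi32.H''` (S modulo (Ind3)^J) HOLDS on VAL** (from S, rp-j3's `H''_of_pilotKummerIndRelated`). [claim: Joshi2024ATSIII, status: disputed] -/
theorem val_J32c : CandJoshi32.H'' (vFull p).toLatticeSituation (valSetting p) (vRho p) (vQDatum p) :=
  CandJoshi32.H''_of_pilotKummerIndRelated _ _ _ _ (val_residual p)

end Summit.ABC.IUTFork.Repair.CandJoshi23

end
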